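import Literature.NumberTheory.EllipticCurves.NeronComponentIndexTypeIVPoints
import HarnessLib

/-!
# Bad points of the type-`IV*` normal form: coordinates, negation, same-label sums

Computations with `K`-points of an equation `J` over a discrete valuation ring `R` in the normal
form of type `IV*` (`a₁ = πα`, `a₂ = π²β`, `a₃ = π²γ`, `a₄ = π³δ`, `a₆ = π⁴ε`; Silverman, *ATAEC*,
IV.9.4 Step 8), used by `NeronComponentIndexTypeIVstarProofs.lean` to prove `c_v ∈ {1, 3}` —
the computations of `NeronComponentIndexTypeIVPoints.lean` two levels deeper:

* `exists_eq_some_of_not_hasNonsingularReduction_IVstar`: a bad point is `(π²x₂, π²y₂)` with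
  `ȳ₂² + γ̄ȳ₂ − ε̄ = 0` (first `π² ∣ y`, `π² ∣ x` by dividing the equation by `π²`, `π³`, then the
  equation divided by `π⁴`);
* `neg_eq_some_IVstar`: `−(π²x₂, π²y₂) = (π²x₂, π²(−y₂ − παx₂ − γ))`;
* `add_eq_some_IVstar`: two bad points with the same label `ȳ₂ = ȳ₂'`, a simple root, add up to
  `(π²X, π²Y)` with `Ȳ = −ȳ₂ − γ̄`: `D = π²·unit`, `π³ ∣ N`, slope `λ = N/D ∈ 𝔪`.

## References

* J. H. Silverman, *Advanced Topics in the Arithmetic of Elliptic Curves*, GTM 151, Springer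
  1994, IV.9.4 Step 8 (PDF p. 346) and its proof (PDF pp. 352–353). [SilvermanATAEC1994]
-/

noncomputable section

open scoped Classical

open IsLocalRing

namespace Literature.NumberTheory.EllipticCurves

namespace LocalIndex

open DiophantineGeometry DiophantineGeometry.TateAlgorithm

variable {R : Type*} [CommRing R] [IsDomain R] [IsDiscreteValuationRing R]
  {K : Type*} [Field K] [Algebra R K] [IsFractionRing R K]

/-- **Bad points of the `IV*` normal form.** With `a₁ = πα`, `a₂ = π²β`, `a₃ = π²γ`, `a₄ = π³δ`,
`a₆ = π⁴ε`, a point of `J(K)` without nonsingular reduction is `(π²x₂, π²y₂)` with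
`y₂² + γy₂ − ε = π(πx₂³ + πβx₂² + δx₂ − αx₂y₂)`, so `ȳ₂` is a root of `Y² + γ̄Y − ε̄`.
[cite: SilvermanATAEC1994, IV.9.4 Step 8] -/
theorem exists_eq_some_of_not_hasNonsingularReduction_IVstar (J : WeierstrassCurve R)
    {ϖ α β γ δ ε : R} (hϖ : Irreducible ϖ) (hα : J.a₁ = ϖ * α) (hβ : J.a₂ = ϖ ^ 2 * β)
    (hγ : J.a₃ = ϖ ^ 2 * γ) (hδ : J.a₄ = ϖ ^ 3 * δ) (hε : J.a₆ = ϖ ^ 4 * ε)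
    {P : (J.baseChange K).toAffine.Point} (hP : ¬ J.HasNonsingularReduction P) :
    ∃ (x₂ y₂ : R) (h : (J.baseChange K).toAffine.Nonsingular (algebraMap R K (ϖ ^ 2 * x₂))
      (algebraMap R K (ϖ ^ 2 * y₂))), P = .some _ _ h ∧
        y₂ ^ 2 + γ * y₂ - ε = ϖ * (ϖ * x₂ ^ 3 + ϖ * β * x₂ ^ 2 + δ * x₂ - α * x₂ * y₂) := by
  have hϖ0 : ϖ ≠ 0 := hϖ.ne_zero
  have hp := hϖ.prime
  have hm : ϖ ∈ maximalIdeal R := (IsLocalRing.mem_maximalIdeal _).mpr hϖ.not_isUnit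
  have h3 : J.a₃ ∈ maximalIdeal R :=
    hγ ▸ Ideal.mul_mem_right _ _ (Ideal.pow_mem_of_mem _ hm 2 two_pos)
  have h4 : J.a₄ ∈ maximalIdeal R :=
    hδ ▸ Ideal.mul_mem_right _ _ (Ideal.pow_mem_of_mem _ hm 3 three_pos)
  have h6 : J.a₆ ∈ maximalIdeal R :=
    hε ▸ Ideal.mul_mem_right _ _ (Ideal.pow_mem_of_mem _ hm 4 four_pos)
  obtain ⟨x, y, h, rfl, hx, hy⟩ := exists_eq_some_of_not_hasNonsingularReduction J h3 h4 h6 hP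
  have he : J.toAffine.Equation x y :=
    (WeierstrassCurve.Affine.map_equation _ (IsFractionRing.injective R K) _ _).mp h.left
  obtain ⟨x₀, rfl⟩ := (mem_maximalIdeal_iff_dvd_of_irreducible hϖ x).mp hx
  obtain ⟨y₀, rfl⟩ := (mem_maximalIdeal_iff_dvd_of_irreducible hϖ y).mp hy
  rw [WeierstrassCurve.Affine.equation_iff, hα, hβ, hγ, hδ, hε] at he
  -- `π ∣ y₀`
  have hy₀ : ϖ ∣ y₀ := by
    refine hp.dvd_of_dvd_pow (n := 2) ((mul_dvd_mul_iff_left (pow_ne_zero 2 hϖ0)).mp ?_)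
    exact ⟨x₀ ^ 3 + ϖ * β * x₀ ^ 2 + ϖ * δ * x₀ + ϖ * ε - α * x₀ * y₀ - γ * y₀,
      by linear_combination he⟩
  obtain ⟨y₂, rfl⟩ := hy₀
  -- `π ∣ x₀`
  have hx₀ : ϖ ∣ x₀ := by
    refine hp.dvd_of_dvd_pow (n := 3) ((mul_dvd_mul_iff_left (pow_ne_zero 3 hϖ0)).mp ?_)
    exact ⟨y₂ ^ 2 + α * x₀ * y₂ + γ * y₂ - β * x₀ ^ 2 - δ * x₀ - ε,
      by linear_combination -he⟩
  obtain ⟨x₂, rfl⟩ := hx₀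
  refine ⟨x₂, y₂, (by ring_nf; ring_nf at h; exact h), ?_, ?_⟩
  · exact point_some_congr (by simp only [map_mul, map_pow]; ring)
      (by simp only [map_mul, map_pow]; ring)
  · exact mul_left_cancel₀ (pow_ne_zero 4 hϖ0) (by linear_combination he)

omit [IsDomain R] [IsDiscreteValuationRing R] [IsFractionRing R K] in
/-- **Negation swaps the label** (normal form of type `IV*`):
`−(π²x₂, π²y₂) = (π²x₂, π²(−y₂ − παx₂ − γ))`. [folklore] -/
theorem neg_eq_some_IVstar (J : WeierstrassCurve R) {ϖ α γ : R} (hα : J.a₁ = ϖ * α)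
    (hγ : J.a₃ = ϖ ^ 2 * γ) {x₂ y₂ : R}
    (h : (J.baseChange K).toAffine.Nonsingular (algebraMap R K (ϖ ^ 2 * x₂))
      (algebraMap R K (ϖ ^ 2 * y₂))) :
    ∃ h', -WeierstrassCurve.Affine.Point.some _ _ h =
      WeierstrassCurve.Affine.Point.some (algebraMap R K (ϖ ^ 2 * x₂))
        (algebraMap R K (ϖ ^ 2 * (-y₂ - ϖ * α * x₂ - γ))) h' := by
  have hneg : (J.baseChange K).toAffine.negY (algebraMap R K (ϖ ^ 2 * x₂))
      (algebraMap R K (ϖ ^ 2 * y₂)) = algebraMap R K (ϖ ^ 2 * (-y₂ - ϖ * α * x₂ - γ)) := by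
    rw [WeierstrassCurve.Affine.negY]
    simp only [WeierstrassCurve.baseChange, WeierstrassCurve.map_a₁, WeierstrassCurve.map_a₃,
      hα, hγ, map_neg, map_sub, map_mul, map_pow]
    ring
  refine ⟨hneg ▸ (WeierstrassCurve.Affine.nonsingular_neg _ _).mpr h, ?_⟩
  rw [WeierstrassCurve.Affine.Point.neg_some]
  exact point_some_congr rfl hneg

/-- **Two bad points with the same label add up to a bad point with the other label** (normal
form of type `IV*`). For `P = (π²x₂, π²y₂)`, `P' = (π²x₂', π²y₂')` with `ȳ₂ = ȳ₂'` a simple root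
of `Y² + γ̄Y − ε̄`: `P + P' ≠ 𝒪`, `D = π²·(2ȳ₂ + γ̄ + …)` is `π²` times a unit and `π³ ∣ N`, so the
slope is `λ = N/D ∈ 𝔪`, and the chord formulas give `P + P' = (π²X, π²Y)` with
`Y ≡ −y₂ − γ (mod π)` (Silverman, *ATAEC*, IV.9.4 Step 8; Table 4.1: `Φ = ℤ/3ℤ`).
[cite: SilvermanATAEC1994, IV.9.4 Step 8] -/
theorem add_eq_some_IVstar (J : WeierstrassCurve R) {ϖ α β γ δ : R} (hϖ : Irreducible ϖ)
    (hα : J.a₁ = ϖ * α) (hβ : J.a₂ = ϖ ^ 2 * β) (hγ : J.a₃ = ϖ ^ 2 * γ) (hδ : J.a₄ = ϖ ^ 3 * δ)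
    {x₂ y₂ x₂' y₂' : R} (hroot : residue R y₂ = residue R y₂')
    (hsimple : 2 * residue R y₂ + residue R γ ≠ 0)
    (h₁ : (J.baseChange K).toAffine.Nonsingular (algebraMap R K (ϖ ^ 2 * x₂))
      (algebraMap R K (ϖ ^ 2 * y₂)))
    (h₂ : (J.baseChange K).toAffine.Nonsingular (algebraMap R K (ϖ ^ 2 * x₂'))
      (algebraMap R K (ϖ ^ 2 * y₂'))) :
    ∃ (X Y : R) (h₃ : (J.baseChange K).toAffine.Nonsingular (algebraMap R K (ϖ ^ 2 * X))
      (algebraMap R K (ϖ ^ 2 * Y))),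
      WeierstrassCurve.Affine.Point.some _ _ h₁ + WeierstrassCurve.Affine.Point.some _ _ h₂ =
        WeierstrassCurve.Affine.Point.some _ _ h₃ ∧ residue R Y = -residue R y₂ - residue R γ := by
  have hϖ0 : ϖ ≠ 0 := hϖ.ne_zero
  have hinj := IsFractionRing.injective R K
  set f := algebraMap R K with hf
  have hfϖ : f ϖ ≠ 0 := (map_ne_zero_iff f hinj).mpr hϖ0
  have hfϖ2 : f ϖ ^ 2 ≠ 0 := pow_ne_zero 2 hfϖ
  have hres0 : residue R ϖ = 0 :=
    (residue_eq_zero_iff _).mpr ((IsLocalRing.mem_maximalIdeal _).mpr hϖ.not_isUnit)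
  -- `P + P' ≠ 𝒪`
  have hxy : ¬ (f (ϖ ^ 2 * x₂) = f (ϖ ^ 2 * x₂') ∧
      f (ϖ ^ 2 * y₂) = (J.baseChange K).toAffine.negY (f (ϖ ^ 2 * x₂')) (f (ϖ ^ 2 * y₂'))) := by
    rintro ⟨-, hy⟩
    rw [WeierstrassCurve.Affine.negY] at hy
    simp only [WeierstrassCurve.baseChange, WeierstrassCurve.map_a₁, WeierstrassCurve.map_a₃,
      hα, hγ, ← hf, map_mul, map_pow] at hy
    have hy' : f (ϖ ^ 2 * (y₂ + y₂' + ϖ * α * x₂' + γ)) = 0 := by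
      simp only [map_add, map_mul, map_pow]; linear_combination hy
    rw [map_eq_zero_iff f hinj, mul_eq_zero] at hy'
    rcases hy' with h0 | h0
    · exact hϖ0 (pow_eq_zero_iff two_ne_zero |>.mp h0)
    · apply hsimple
      have := congrArg (residue R) h0
      simp only [map_add, map_mul, hres0, zero_mul, add_zero, map_zero, ← hroot] at this
      linear_combination this
  -- `D = ϖ² d` with `d` a unit, `N = ϖ³ n₀`
  set d : R := y₂ + y₂' + ϖ * α * x₂ + γ with hd
  set n₀ : R := ϖ * (x₂ ^ 2 + x₂ * x₂' + x₂' ^ 2) + ϖ * β * (x₂ + x₂') + δ - α * y₂' with hn₀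
  have hdu : IsUnit d := by
    rw [isUnit_iff_residue_ne_zero, hd]
    simp only [map_add, map_mul, hres0, zero_mul, add_zero, ← hroot]
    convert hsimple using 1; ring
  have hLD := slope_mul_eq h₁.1 h₂.1 hxy
  have eD : f (ϖ ^ 2 * y₂) + f (ϖ ^ 2 * y₂') + (J.baseChange K).toAffine.a₁ * f (ϖ ^ 2 * x₂) +
      (J.baseChange K).toAffine.a₃ = f ϖ ^ 2 * f d := by
    simp only [WeierstrassCurve.baseChange, WeierstrassCurve.map_a₁, WeierstrassCurve.map_a₃, hα,
      hγ, hd, ← hf, map_add, map_mul, map_pow]; ring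
  have eN : f (ϖ ^ 2 * x₂) ^ 2 + f (ϖ ^ 2 * x₂) * f (ϖ ^ 2 * x₂') + f (ϖ ^ 2 * x₂') ^ 2 +
      (J.baseChange K).toAffine.a₂ * (f (ϖ ^ 2 * x₂) + f (ϖ ^ 2 * x₂')) +
      (J.baseChange K).toAffine.a₄ - (J.baseChange K).toAffine.a₁ * f (ϖ ^ 2 * y₂') =
        f ϖ ^ 2 * (f ϖ * f n₀) := by
    simp only [WeierstrassCurve.baseChange, WeierstrassCurve.map_a₁, WeierstrassCurve.map_a₂,
      WeierstrassCurve.map_a₄, hα, hβ, hδ, hn₀, ← hf, map_add, map_sub, map_mul, map_pow]; ring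
  rw [eD, eN, ← mul_assoc, mul_comm _ (f ϖ ^ 2), mul_assoc] at hLD
  have hLd := mul_left_cancel₀ hfϖ2 hLD
  -- `λ = ϖ ℓ`
  set ℓ : R := n₀ * ↑hdu.unit⁻¹ with hℓ
  set L := (J.baseChange K).toAffine.slope (f (ϖ ^ 2 * x₂)) (f (ϖ ^ 2 * x₂')) (f (ϖ ^ 2 * y₂))
    (f (ϖ ^ 2 * y₂')) with hL
  have hd0 : f d ≠ 0 := (map_ne_zero_iff _ hinj).mpr hdu.ne_zero
  have hLeq : L = f (ϖ * ℓ) := by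
    rw [← mul_left_inj' hd0, hLd, hℓ, ← map_mul, ← map_mul, mul_assoc, mul_assoc,
      IsUnit.val_inv_mul, mul_one]
  -- the coordinates of the sum
  set X : R := ℓ ^ 2 + α * ℓ - β - x₂ - x₂' with hX
  set Y : R := -(ϖ * ℓ * (X - x₂)) - y₂ - ϖ * α * X - γ with hY
  have eX : (J.baseChange K).toAffine.addX (f (ϖ ^ 2 * x₂)) (f (ϖ ^ 2 * x₂')) L =
      f (ϖ ^ 2 * X) := by
    rw [WeierstrassCurve.Affine.addX, hLeq]
    simp only [WeierstrassCurve.baseChange, WeierstrassCurve.map_a₁, WeierstrassCurve.map_a₂, hα,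
      hβ, hX, ← hf, map_add, map_sub, map_mul, map_pow]; ring
  have eY : (J.baseChange K).toAffine.addY (f (ϖ ^ 2 * x₂)) (f (ϖ ^ 2 * x₂')) (f (ϖ ^ 2 * y₂)) L =
      f (ϖ ^ 2 * Y) := by
    rw [WeierstrassCurve.Affine.addY, WeierstrassCurve.Affine.negAddY, WeierstrassCurve.Affine.negY,
      eX, hLeq]
    simp only [WeierstrassCurve.baseChange, WeierstrassCurve.map_a₁, WeierstrassCurve.map_a₃, hα,
      hγ, hY, ← hf, map_sub, map_mul, map_neg, map_pow]; ring
  refine ⟨X, Y, ?_, ?_, ?_⟩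
  · have h₃ := WeierstrassCurve.Affine.nonsingular_add h₁ h₂ hxy
    rwa [eX, eY] at h₃
  · rw [WeierstrassCurve.Affine.Point.add_some hxy]
    exact point_some_congr eX eY
  · rw [hY]
    simp only [map_sub, map_neg, map_mul, hres0, zero_mul, neg_zero, zero_sub]
    ring

end LocalIndex

end Literature.NumberTheory.EllipticCurves

end
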